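import Summits.Ventures.PercRepro.SixFourResidueS0Count

/-!
# PercRepro — C-025 at `(6,4)`: the structure `S₀` of §21.18.9.3, the COUNTING half, part B (p2, gen 8; Mathlib only
beyond part A) — the remaining feasible covering pairs, the five impossible ones, and the count `≤ 50`.
-/

namespace PercRepro.SixFour.S0

variable {α : Type*} [DecidableEq α]

section Fam

variable {ρ L : Finset α} {z : α}

/-- The part of `Z` forced by `T₂ = {x} ∪ μ`: `{z} ∪ (L ∖ {x}) ⊆ Z`. -/
theorem insert_erase_subset_of (hdisj : ∀ v ∈ L, v ∉ ρ) (hz : z ∈ ρ) {x : α} (hx : x ∈ L) {Z : Finset α}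
    (hZ2 : (ρ ∪ L) \ Z ⊆ insert x (ρ.erase z)) : insert z (L.erase x) ⊆ Z := by
  intro v hv
  rw [Finset.mem_insert, Finset.mem_erase] at hv
  rcases hv with rfl | ⟨hvx, hvL⟩
  · refine mem_of_notMem hZ2 (Finset.mem_union_left _ hz) ?_
    rw [Finset.mem_insert, Finset.mem_erase]
    rintro (h | h)
    · exact hdisj x hx (h ▸ hz)
    · exact h.1 rfl
  · refine mem_of_notMem hZ2 (Finset.mem_union_right _ hvL) ?_
    rw [Finset.mem_insert, Finset.mem_erase]
    rintro (h | h)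
    · exact hvx h
    · exact hdisj v hvL h.2

/-- `(T₁, T₂) = (L ∪ {z, y}, {x} ∪ μ)`: `{z} ∪ (L ∖ {x}) ⊆ Z ⊆ L ∪ {z, y}`. -/
theorem combo_Ay_Bx (hdisj : ∀ v ∈ L, v ∉ ρ) (hz : z ∈ ρ) {y x : α} (hy : y ∈ ρ.erase z) (hx : x ∈ L) {Z : Finset α}
    (hZ1 : Z ⊆ insert y (insert z L)) (hZ2 : (ρ ∪ L) \ Z ⊆ insert x (ρ.erase z)) : Z ∈ Fam ρ L z := by
  have hCZ := insert_erase_subset_of hdisj hz hx hZ2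
  have hzZ : z ∈ Z := hCZ (Finset.mem_insert_self _ _)
  have hLx : ∀ v ∈ L, v ≠ x → v ∈ Z := fun v hv hvx => hCZ (Finset.mem_insert_of_mem (Finset.mem_erase.2 ⟨hvx, hv⟩))
  by_cases hyZ : y ∈ Z <;> by_cases hxZ : x ∈ Z
  · have hZeq : Z = insert y (insert z L) := Finset.Subset.antisymm hZ1 (by
      intro v hv
      rw [Finset.mem_insert, Finset.mem_insert] at hv
      rcases hv with rfl | rfl | hv
      · exact hyZ
      · exact hzZ
      · by_cases hvx : v = x
        · exact hvx ▸ hxZ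
        exact hLx v hv hvx)
    rw [hZeq]
    exact mem_Fam_2 hy
  · have hZeq : Z = insert y (insert z (L.erase x)) := by
      apply Finset.Subset.antisymm
      · intro v hv
        have := hZ1 hv
        rw [Finset.mem_insert, Finset.mem_insert] at this
        rw [Finset.mem_insert, Finset.mem_insert, Finset.mem_erase]
        rcases this with h | h | h
        · exact Or.inl h
        · exact Or.inr (Or.inl h)
        · exact Or.inr (Or.inr ⟨fun hvx => hxZ (hvx ▸ hv), h⟩)
      · intro v hv
        rw [Finset.mem_insert] at hv
        rcases hv with rfl | hv
        · exact hyZ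
        · exact hCZ hv
    rw [hZeq]
    exact mem_Fam_8 hx hy
  · have hZeq : Z = insert z L := by
      apply Finset.Subset.antisymm
      · intro v hv
        have := hZ1 hv
        rw [Finset.mem_insert, Finset.mem_insert] at this
        rw [Finset.mem_insert]
        rcases this with h | h | h
        · exact absurd (h ▸ hv) hyZ
        · exact Or.inl h
        · exact Or.inr h
      · intro v hv
        rw [Finset.mem_insert] at hv
        rcases hv with rfl | hv
        · exact hzZ
        · by_cases hvx : v = x
          · exact hvx ▸ hxZ
          exact hLx v hv hvx
    rw [hZeq]
    exact mem_Fam_base (Or.inr (Or.inl rfl))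
  · have hZeq : Z = insert z (L.erase x) := by
      apply Finset.Subset.antisymm
      · intro v hv
        have := hZ1 hv
        rw [Finset.mem_insert, Finset.mem_insert] at this
        rw [Finset.mem_insert, Finset.mem_erase]
        rcases this with h | h | h
        · exact absurd (h ▸ hv) hyZ
        · exact Or.inl h
        · exact Or.inr ⟨fun hvx => hxZ (hvx ▸ hv), h⟩
      · exact hCZ
    rw [hZeq]
    exact mem_Fam_7 hx

/-- `(T₁, T₂) = ({x} ∪ μ, L ∪ {z, y})`: `μ ∖ {y} ⊆ Z ⊆ {x} ∪ μ`. -/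
theorem combo_Bx_Ay (hdisj : ∀ v ∈ L, v ∉ ρ) {y x : α} (hy : y ∈ ρ.erase z) (hx : x ∈ L) {Z : Finset α}
    (hZ1 : Z ⊆ insert x (ρ.erase z)) (hZ2 : (ρ ∪ L) \ Z ⊆ insert y (insert z L)) : Z ∈ Fam ρ L z := by
  have hμZ : (ρ.erase z).erase y ⊆ Z := fun v hv => by
    rw [Finset.mem_erase, Finset.mem_erase] at hv
    refine mem_of_notMem hZ2 (Finset.mem_union_left _ hv.2.2) ?_
    rw [Finset.mem_insert, Finset.mem_insert]
    rintro (h | h | h)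
    · exact hv.1 h
    · exact hv.2.1 h
    · exact hdisj v h hv.2.2
  by_cases hyZ : y ∈ Z <;> by_cases hxZ : x ∈ Z
  · have hZeq : Z = insert x (ρ.erase z) := Finset.Subset.antisymm hZ1 (by
      intro v hv
      rw [Finset.mem_insert] at hv
      rcases hv with rfl | hv
      · exact hxZ
      · by_cases hvy : v = y
        · exact hvy ▸ hyZ
        exact hμZ (Finset.mem_erase.2 ⟨hvy, hv⟩))
    rw [hZeq]
    exact mem_Fam_6 hx
  · have hZeq : Z = ρ.erase z := by
      apply Finset.Subset.antisymm
      · intro v hv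
        have := hZ1 hv
        rw [Finset.mem_insert] at this
        rcases this with h | h
        · exact absurd (h ▸ hv) hxZ
        · exact h
      · intro v hv
        by_cases hvy : v = y
        · exact hvy ▸ hyZ
        exact hμZ (Finset.mem_erase.2 ⟨hvy, hv⟩)
    rw [hZeq]
    exact mem_Fam_base (Or.inr (Or.inr (Or.inl rfl)))
  · have hZeq : Z = insert x ((ρ.erase z).erase y) := by
      apply Finset.Subset.antisymm
      · intro v hv
        have := hZ1 hv
        rw [Finset.mem_insert] at this
        rw [Finset.mem_insert, Finset.mem_erase]
        rcases this with h | h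
        · exact Or.inl h
        · exact Or.inr ⟨fun hvy => hyZ (hvy ▸ hv), h⟩
      · intro v hv
        rw [Finset.mem_insert] at hv
        rcases hv with rfl | hv
        · exact hxZ
        · exact hμZ hv
    rw [hZeq]
    exact mem_Fam_5 hy hx
  · have hZeq : Z = (ρ.erase z).erase y := by
      apply Finset.Subset.antisymm
      · intro v hv
        have := hZ1 hv
        rw [Finset.mem_insert] at this
        rw [Finset.mem_erase]
        rcases this with h | h
        · exact absurd (h ▸ hv) hxZ
        · exact ⟨fun hvy => hyZ (hvy ▸ hv), h⟩
      · exact hμZ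
    rw [hZeq]
    exact mem_Fam_3 hy

/-- **Every set with a listed superset and a listed co-superset is in `Fam`** (the five feasible covering pairs;
the four others are impossible). -/
theorem mem_Fam_of_listed (hρ : ρ.card = 5) (hz : z ∈ ρ) (hL : L.card = 3) (hdisj : ∀ v ∈ L, v ∉ ρ)
    {Z T₁ T₂ : Finset α} (h1 : Listed ρ L z T₁) (h2 : Listed ρ L z T₂) (hZ1 : Z ⊆ T₁)
    (hZ2 : (ρ ∪ L) \ Z ⊆ T₂) : Z ∈ Fam ρ L z := by
  have hL1 : 1 < L.card := by omega
  have hμ : (ρ.erase z).card = 4 := by rw [Finset.card_erase_of_mem hz, hρ]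
  rcases h1 with rfl | ⟨y, hy, rfl⟩ | ⟨x, hx, rfl⟩ <;> rcases h2 with rfl | ⟨y', hy', rfl⟩ | ⟨x', hx', rfl⟩
  · -- (ρ, ρ): impossible — `L ⊆ Z ⊆ ρ`
    exfalso
    obtain ⟨v, hv⟩ := Finset.card_pos.1 (by omega : 0 < L.card)
    exact hdisj v hv (hZ1 (mem_of_notMem hZ2 (Finset.mem_union_right _ hv) (hdisj v hv)))
  · exact combo_rho_Ay hdisj hy' hZ1 hZ2
  · -- (ρ, {x′} ∪ μ): impossible — a point of `L ∖ {x′}` is in `Z ⊆ ρ`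
    exfalso
    obtain ⟨v, hv, hvx⟩ := Finset.exists_mem_ne hL1 x'
    exact hdisj v hv (hZ1 (insert_erase_subset_of hdisj hz hx' hZ2
      (Finset.mem_insert_of_mem (Finset.mem_erase.2 ⟨hvx, hv⟩))))
  · exact combo_Ay_rho hdisj hy hZ1 hZ2
  · -- (L ∪ {z, y}, L ∪ {z, y′}): impossible — `μ ∖ {y′} ⊆ Z` has a point other than `y`
    exfalso
    have h3 : 1 < ((ρ.erase z).erase y').card := by rw [Finset.card_erase_of_mem hy', hμ]; norm_num
    obtain ⟨v, hv, hvy⟩ := Finset.exists_mem_ne h3 y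
    rw [Finset.mem_erase, Finset.mem_erase] at hv
    have hvZ : v ∈ Z := mem_of_notMem hZ2 (Finset.mem_union_left _ hv.2.2) (by
      rw [Finset.mem_insert, Finset.mem_insert]
      rintro (h | h | h)
      · exact hv.1 h
      · exact hv.2.1 h
      · exact hdisj v h hv.2.2)
    have := hZ1 hvZ
    rw [Finset.mem_insert, Finset.mem_insert] at this
    rcases this with h | h | h
    · exact hvy h
    · exact hv.2.1 h
    · exact hdisj v h hv.2.2
  · exact combo_Ay_Bx hdisj hz hy hx' hZ1 hZ2
  · -- ({x} ∪ μ, ρ): impossible — a point of `L ∖ {x}` is in `Z ⊆ {x} ∪ μ`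
    exfalso
    obtain ⟨v, hv, hvx⟩ := Finset.exists_mem_ne hL1 x
    have hvZ : v ∈ Z := mem_of_notMem hZ2 (Finset.mem_union_right _ hv) (hdisj v hv)
    have := hZ1 hvZ
    rw [Finset.mem_insert, Finset.mem_erase] at this
    rcases this with h | h
    · exact hvx h
    · exact hdisj v hv h.2
  · exact combo_Bx_Ay hdisj hy' hx hZ1 hZ2
  · -- ({x} ∪ μ, {x′} ∪ μ): impossible — `z ∈ Z ⊆ {x} ∪ μ`
    exfalso
    have hzZ : z ∈ Z := insert_erase_subset_of hdisj hz hx' hZ2 (Finset.mem_insert_self _ _)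
    have := hZ1 hzZ
    rw [Finset.mem_insert, Finset.mem_erase] at this
    rcases this with h | h
    · exact hdisj x hx (h ▸ hz)
    · exact h.1 rfl

/-- **The count**: a family of subsets of `ρ ∪ L`, each inside a listed set and with complement inside a listed
set, has at most `50` members. -/
theorem card_le_fifty (hρ : ρ.card = 5) (hz : z ∈ ρ) (hL : L.card = 3) (hdisj : ∀ v ∈ L, v ∉ ρ)
    (S : Finset (Finset α))
    (hS : ∀ Z ∈ S, (∃ T₁, Listed ρ L z T₁ ∧ Z ⊆ T₁) ∧ (∃ T₂, Listed ρ L z T₂ ∧ (ρ ∪ L) \ Z ⊆ T₂)) :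
    S.card ≤ 50 := by
  refine (Finset.card_le_card fun Z hZ => ?_).trans (card_Fam_le ρ L z hρ hz hL)
  obtain ⟨⟨T₁, h1, hZ1⟩, ⟨T₂, h2, hZ2⟩⟩ := hS Z hZ
  exact mem_Fam_of_listed hρ hz hL hdisj h1 h2 hZ1 hZ2

end Fam

end PercRepro.SixFour.S0
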